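import Summits.CriticalPhenomena.CardyFormulaZ2.Theorems.CardyComplexConeParafermionToSLESixFamiliesDiamondTraceCellGap
import Summits.CriticalPhenomena.CardyFormulaZ2.Theorems.CardyComplexConeParafermionToSLESixFamiliesDiamondTraceChain
import Summits.CriticalPhenomena.CardyFormulaZ2.Theorems.CardyComplexConeParafermionToSLESixFamiliesDiamondTraceTouchFKG
import HarnessLib

/-!
# The free-side core of the boundary trace: the chain sum in the direction `u δ · τ` and the domination of the
# touch mass by the chain (line `potential-darboux-picard-diamond`, S1‴ assembly, one free side at one mesh)

Crux `ParafermionToSLESixFamilies` (stmt-CriticalPhenomena-11389), line `potential-darboux-picard-diamond`, stub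
`stub_exactPotentialTracePh3` (S1‴). ONE admissible datum `E` on the open tilted rectangle of a side frame (`‖e‖ = 1`, chart
`(A, B) = (layerFn j, layerFn (j+1))`, coordinates `(δ/√2)A + X₀` across, `(δ/√2)B + Y₀` along, last inside layer `n`), a
window `[Yl, Yr]` of ordinates in the bulk, and the two eventual hypotheses of the assembly on it: (ARC) the layers `n−4 … n`
are off the wired arc and on the dual-wired one when boundary sites (`eventually_arcs_near_freeSegment`), (PHASE) the passage
phase at the first touch dart `(x, j)` of every touch site is `d · conj(iʲ e^{-iπ/6})` for ONE unit `d` (`BoundaryDartPhase`).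
* `bulk_of_chart`, `touchRow_of_chart` — window sites are in the bulk; chain sites (`A x = n − 2`) satisfy the lattice
  hypotheses of the chain sum;
* `free_chainSum_of_chart` — along `x_i = x − i(u_j + u_{j+1})`: `Ψ (faceAt x_N j) − Ψ (faceAt x_0 j) = √3·d·Σ_{i<N} touchProb E x_i`;
* `layer_of_touchSite`, `touchProb_le_two_mul_shift` — touch sites of the window lie on layers `n − 2, n − 3`, and a
  layer-`(n−3)` touch probability is at most twice that of its chain neighbour (Harris–FKG, `touchProb_le_two_mul_of_adj`);
* `sum_touchProb_window_le` (registered) — **the touch mass strictly between two chain sites is `≤ 3 ×` the chain sum**.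
-/

noncomputable section

namespace Summit.CriticalPhenomena.CardyFormulaZ2.Cruxes.ParafermionToSLESixFamilies.PotentialDarbouxPicardDiamond

open scoped BigOperators
open Set Metric Complex MeasureTheory
open Literature.Probability Literature.Probability.LatticeModels Literature.Probability.Percolation
open Literature.Probability.LatticeModels.DiscreteDobrushin
open Literature.Probability.RandomPlanarGeometry
open Summit.CriticalPhenomena.CardyFormulaZ2.Cruxes.EdgePrecompact.QkzStripBoundaryArm (cornerObs)
open Summit.CriticalPhenomena.CardyFormulaZ2.Cruxes.ParafermionToSLESixFamilies.IicTraceFluxPairing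
  (touchSites touchProb touchProb_nonneg touchProb_le_one)

/-! ## Unit phases -/

/-- `iʲ · e^{-iπ/6}` is unimodular. -/
theorem norm_I_pow_mul_exp (j : ℕ) (r : ℝ) : ‖I ^ j * Complex.exp ((r : ℂ) * I)‖ = 1 := by
  rw [norm_mul, norm_pow, norm_I, one_pow, one_mul, norm_exp_ofReal_mul_I]

/-- Division by a unimodular number: `z · w = d` gives `z = d · conj w`. -/
theorem eq_mul_conj_of_mul_eq {z w d : ℂ} (hw : ‖w‖ = 1) (h : z * w = d) : z = d * (starRingEnd ℂ) w := by
  have hww : w * (starRingEnd ℂ) w = 1 := by rw [mul_conj, normSq_eq_norm_sq, hw]; norm_num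
  rw [← h, mul_assoc, hww, mul_one]

/-- … and back: `w · (d · conj w) = d`. -/
theorem mul_mul_conj_of_norm_one {w : ℂ} (hw : ‖w‖ = 1) (d : ℂ) : w * (d * (starRingEnd ℂ) w) = d := by
  have hww : w * (starRingEnd ℂ) w = 1 := by rw [mul_conj, normSq_eq_norm_sq, hw]; norm_num
  calc w * (d * (starRingEnd ℂ) w) = d * (w * (starRingEnd ℂ) w) := by ring
    _ = d := by rw [hww, mul_one]

/-- The unit `iʲ e^{-iπ/6}` of the free side. -/
theorem norm_I_pow_mul_exp_neg (j : ℕ) : ‖I ^ j * Complex.exp (-(Real.pi / 6 : ℝ) * I)‖ = 1 := by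
  have h := norm_I_pow_mul_exp j (-(Real.pi / 6))
  simp only [Complex.ofReal_neg] at h
  exact h

/-- `δ/√2 ≤ δ`. -/
theorem sqrt_two_half_mul_le {δ : ℝ} (hδ : 0 < δ) : Real.sqrt 2 / 2 * δ ≤ δ := by
  have hs2 : Real.sqrt 2 < 1.415 := by rw [Real.sqrt_lt' (by norm_num)]; norm_num
  nlinarith

section Core

variable {c e : ℂ} (he : ‖e‖ = 1) {α β δ : ℝ} (hδ : 0 < δ) (hα : 4 * δ ≤ α) {E : DiscreteDobrushin}
  (hΩ : E.Ω = {z : ℂ | |((z - c) * e).re| < α ∧ |((z - c) * e).im| < β}) (hEδ : E.δ = δ) (hE : E.IsZdAdmissible)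
  (hgood : ∀ x : Site 2, meshPoint δ x ∈ E.Ω → x ∈ meshDomain E.Ω δ)
  {j : Fin 4} {X₀ Y₀ : ℝ} (hX : ∀ x : Site 2, ((meshPoint δ x - c) * e).re = Real.sqrt 2 / 2 * δ * layerFn j x + X₀)
  (hY : ∀ x : Site 2, ((meshPoint δ x - c) * e).im = Real.sqrt 2 / 2 * δ * layerFn (j + 1) x + Y₀)
  {n : ℤ} (hn : Real.sqrt 2 / 2 * δ * n + X₀ < α) (hn' : α ≤ Real.sqrt 2 / 2 * δ * (n + 1) + X₀)
  {Yl Yr : ℝ} (hYl : -β + 3 * δ < Yl) (hYr : Yr + 3 * δ < β)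
  (hArc : ∀ x : Site 2, n - 4 ≤ layerFn j x → layerFn j x ≤ n → Yl ≤ ((meshPoint δ x - c) * e).im →
    ((meshPoint δ x - c) * e).im ≤ Yr → x ∉ E.zdArcA ∧ (x ∈ E.zdBoundary → x ∈ E.zdArcB))
  {d : ℂ}
  (hPh : ∀ x : Site 2, layerFn j x = n - 2 → Yl ≤ ((meshPoint δ x - c) * e).im → ((meshPoint δ x - c) * e).im ≤ Yr →
    E.IsInnerFace (faceAt x j) → x ∉ E.zdArcB → x + cornerUnit (j + 1) ∈ E.zdArcB → x + cornerUnit (j + 2) ∈ E.zdArcB →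
    ∀ (ω : BondConfig (Site 2)) (t : ℕ), t < exitTime hE ω →
      cornerOrbit (E.bcBondConfig ω) (startCorner hE) t = (x, j) →
      Complex.exp (-(Real.pi / 6 * turnCount (E.bcBondConfig ω) (startCorner hE) t : ℝ) * I) * I ^ (j : ℕ) *
        Complex.exp (((-(Real.pi / 6) : ℝ) : ℂ) * I) = d)

/-! ## Chart bookkeeping -/

include hY in
/-- The ordinate of a neighbour: `Y(δ(x + u_{j+m})) = Y(δx) + (δ/√2)·(−1,−1,1,1)ₘ`. -/
theorem im_tilt_add_cornerUnit (x : Site 2) (m : Fin 4) : ((meshPoint δ (x + cornerUnit (j + m)) - c) * e).im =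
    ((meshPoint δ x - c) * e).im + Real.sqrt 2 / 2 * δ * ((![-1, -1, 1, 1] m : ℤ) : ℝ) := by
  rw [hY, hY, layerFn_succ_add_cornerUnit]; push_cast; ring

include hY in
/-- The ordinates of the four neighbours `x + u_{j+1}`, `x + u_{j+2}`, `x + u_{j+3}`, `x + u_j`. -/
theorem im_tilt_neighbours (x : Site 2) :
    ((meshPoint δ (x + cornerUnit (j + 1)) - c) * e).im = ((meshPoint δ x - c) * e).im - Real.sqrt 2 / 2 * δ ∧
      ((meshPoint δ (x + cornerUnit (j + 2)) - c) * e).im = ((meshPoint δ x - c) * e).im + Real.sqrt 2 / 2 * δ ∧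
      ((meshPoint δ (x + cornerUnit (j + 3)) - c) * e).im = ((meshPoint δ x - c) * e).im + Real.sqrt 2 / 2 * δ ∧
      ((meshPoint δ (x - cornerUnit j) - c) * e).im = ((meshPoint δ x - c) * e).im + Real.sqrt 2 / 2 * δ := by
  have h1 := im_tilt_add_cornerUnit hY x 1
  have h2 := im_tilt_add_cornerUnit hY x 2
  have h3 := im_tilt_add_cornerUnit hY x 3
  have h0 := im_tilt_add_cornerUnit hY (x - cornerUnit j) 0
  rw [add_zero, sub_add_cancel] at h0
  simp only [Matrix.cons_val_one, Matrix.cons_val_zero, Matrix.cons_val, Int.cast_one, Int.cast_neg] at h1 h2 h3 h0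
  refine ⟨by rw [h1]; ring, by rw [h2]; ring, by rw [h3]; ring, by linarith⟩

include hY in
/-- The ordinate along the chain: `Y(δ x_i) = Y(δ x) + √2 δ i`. -/
theorem im_tilt_chainSite (x : Site 2) (i : ℕ) :
    ((meshPoint δ (x - (i : ℤ) • (cornerUnit j + cornerUnit (j + 1))) - c) * e).im =
      ((meshPoint δ x - c) * e).im + Real.sqrt 2 * δ * i := by
  rw [hY, hY, layerFn_succ_chainSite]; push_cast; ring

include hY hδ in
/-- The ordinate orders the chain layer: on one layer, `Y(δx) < Y(δy)` iff `B x < B y`. -/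
theorem layerFn_succ_lt_iff (x y : Site 2) :
    ((meshPoint δ x - c) * e).im < ((meshPoint δ y - c) * e).im ↔ layerFn (j + 1) x < layerFn (j + 1) y := by
  rw [hY, hY, add_lt_add_iff_right, mul_lt_mul_iff_of_pos_left (by positivity : 0 < Real.sqrt 2 / 2 * δ), Int.cast_lt]

include hδ hα hX hn' hYl hYr in
/-- **Sites of layer `≥ n − 6` with ordinate in the window are in the bulk of the side.** -/
theorem bulk_of_chart {x : Site 2} (hA : n - 6 ≤ layerFn j x) (h1 : Yl ≤ ((meshPoint δ x - c) * e).im)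
    (h2 : ((meshPoint δ x - c) * e).im ≤ Yr) :
    |((meshPoint δ x - c) * e).im| + 3 * δ < β ∧ -α + 3 * δ < ((meshPoint δ x - c) * e).re := by
  refine ⟨?_, ?_⟩
  · rcases le_or_gt 0 ((meshPoint δ x - c) * e).im with h | h
    · rw [abs_of_nonneg h]; linarith
    · rw [abs_of_neg h]; linarith
  · rw [hX]
    have hs2 : Real.sqrt 2 < 1.415 := by rw [Real.sqrt_lt' (by norm_num)]; norm_num
    have hs2δ : Real.sqrt 2 * δ < 1.415 * δ := mul_lt_mul_of_pos_right hs2 hδ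
    have hle : ((n : ℝ) - 6) ≤ (layerFn j x : ℝ) := by exact_mod_cast hA
    have hmul : Real.sqrt 2 / 2 * δ * ((n : ℝ) - 6) ≤ Real.sqrt 2 / 2 * δ * (layerFn j x : ℝ) :=
      mul_le_mul_of_nonneg_left hle (by positivity)
    linarith

include he hδ hα hΩ hX hn hn' hYl hYr in
/-- Sites of layer `n − 6 … n` with ordinate in the window are in the carrier. -/
theorem mem_carrier_of_chart {x : Site 2} (hA : n - 6 ≤ layerFn j x) (hA' : layerFn j x ≤ n)
    (h1 : Yl ≤ ((meshPoint δ x - c) * e).im) (h2 : ((meshPoint δ x - c) * e).im ≤ Yr) : meshPoint δ x ∈ E.Ω := by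
  obtain ⟨hY', hX'⟩ := bulk_of_chart hδ hα hX hn' hYl hYr hA h1 h2
  exact (mem_carrier_iff_layerFn_le_self he hδ hΩ hX hn hn' hY' hX').2 hA'

include he hδ hα hΩ hEδ hgood hX hn hn' hYl hYr in
/-- Sites of layer `n − 6 … n − 2` with ordinate in the window are off the discrete boundary, hence off both arcs. -/
theorem not_mem_arcs_of_chart {x : Site 2} (hA : n - 6 ≤ layerFn j x) (hA' : layerFn j x ≤ n - 2)
    (h1 : Yl ≤ ((meshPoint δ x - c) * e).im) (h2 : ((meshPoint δ x - c) * e).im ≤ Yr) :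
    x ∉ E.zdBoundary ∧ x ∉ E.zdArcA ∧ x ∉ E.zdArcB := by
  obtain ⟨hY', hX'⟩ := bulk_of_chart hδ hα hX hn' hYl hYr hA h1 h2
  have hin := mem_carrier_of_chart he hδ hα hΩ hX hn hn' hYl hYr hA (by omega) h1 h2
  have hnot : x ∉ E.zdBoundary := fun hb => by
    have := (mem_zdBoundary_iff_layerFn' he hδ hΩ hEδ hgood hX hn hn' hY' hX' hin).1 hb
    omega
  exact ⟨hnot, fun h => hnot (E.zdArcA_subset_zdBoundary h), fun h => hnot (E.zdArcB_subset_zdBoundary h)⟩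

include he hδ hα hΩ hEδ hgood hX hn hn' hYl hYr in
/-- Inner faces around a site of the window are read off the layer. -/
theorem isInnerFace_of_chart {x : Site 2} (hA : n - 6 ≤ layerFn j x) (h1 : Yl ≤ ((meshPoint δ x - c) * e).im)
    (h2 : ((meshPoint δ x - c) * e).im ≤ Yr) (m : Fin 4) (hle : layerFn j x + faceRise m ≤ n) :
    E.IsInnerFace (faceAt x (j + m)) := by
  obtain ⟨hY', hX'⟩ := bulk_of_chart hδ hα hX hn' hYl hYr hA h1 h2
  exact (isInnerFace_faceAt_iff_layerFn he hδ hΩ hEδ hgood hX hn hn' hY' hX' m).2 hle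

/-! ## The chain sites of a free side -/

include he hδ hα hΩ hEδ hgood hX hY hn hn' hYl hYr hArc in
/-- **A chain site of a free side satisfies the lattice hypotheses of the chain sum**: off both arcs, its two outward
neighbours on the dual-wired arc, its faces `j, j+1, j+2` inner. -/
theorem touchRow_of_chart {x : Site 2} (hA : layerFn j x = n - 2) (h1 : Yl + δ ≤ ((meshPoint δ x - c) * e).im)
    (h2 : ((meshPoint δ x - c) * e).im ≤ Yr - δ) :
    x ∉ E.zdArcA ∧ x ∉ E.zdArcB ∧ x + cornerUnit (j + 1) ∈ E.zdArcB ∧ x + cornerUnit (j + 2) ∈ E.zdArcB ∧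
      E.IsInnerFace (faceAt x j) ∧ E.IsInnerFace (faceAt x (j + 1)) ∧ E.IsInnerFace (faceAt x (j + 2)) := by
  have hh : Real.sqrt 2 / 2 * δ ≤ δ := sqrt_two_half_mul_le hδ
  obtain ⟨hY1, hY2, -, -⟩ := im_tilt_neighbours hY x
  have hA1 : layerFn j (x + cornerUnit (j + 1)) = n - 1 := by
    rw [layerFn_add_cornerUnit]; simp only [Matrix.cons_val_one, Matrix.cons_val_zero]; omega
  have hA2 : layerFn j (x + cornerUnit (j + 2)) = n - 1 := by
    rw [layerFn_add_cornerUnit]; simp only [Matrix.cons_val]; omega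
  obtain ⟨bY, bX⟩ := bulk_of_chart hδ hα hX hn' hYl hYr (x := x) (by omega) (by linarith) (by linarith)
  obtain ⟨bY1, bX1⟩ := bulk_of_chart hδ hα hX hn' hYl hYr (x := x + cornerUnit (j + 1)) (by omega)
    (by rw [hY1]; linarith) (by rw [hY1]; linarith)
  obtain ⟨bY2, bX2⟩ := bulk_of_chart hδ hα hX hn' hYl hYr (x := x + cornerUnit (j + 2)) (by omega)
    (by rw [hY2]; linarith) (by rw [hY2]; linarith)
  obtain ⟨hxb, hb1, hb2, hf0, hf1, hf2⟩ := touchRow_of_layerFn_eq he hδ hΩ hEδ hgood hX hn hn' bY bX hA bY1 bX1 bY2 bX2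
  obtain ⟨hxA, -⟩ := hArc x (by omega) (by omega) (by linarith) (by linarith)
  obtain ⟨-, hB1⟩ := hArc (x + cornerUnit (j + 1)) (by omega) (by omega) (by rw [hY1]; linarith) (by rw [hY1]; linarith)
  obtain ⟨-, hB2⟩ := hArc (x + cornerUnit (j + 2)) (by omega) (by omega) (by rw [hY2]; linarith) (by rw [hY2]; linarith)
  exact ⟨hxA, fun h => hxb (E.zdArcB_subset_zdBoundary h), hB1 hb1, hB2 hb2, hf0, hf1, hf2⟩

include he hδ hα hΩ hEδ hgood hX hY hn hn' hYl hYr hArc hPh in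
/-- **The passage phase at a chain dart of a free side is the constant `d · conj(iʲ e^{-iπ/6})`.** -/
theorem phase_of_chart {x : Site 2} (hA : layerFn j x = n - 2) (h1 : Yl + δ ≤ ((meshPoint δ x - c) * e).im)
    (h2 : ((meshPoint δ x - c) * e).im ≤ Yr - δ) (ω : BondConfig (Site 2)) (t : ℕ) (ht : t < exitTime hE ω)
    (horb : cornerOrbit (E.bcBondConfig ω) (startCorner hE) t = (x, j)) :
    Complex.exp (-(Real.pi / 6 * turnCount (E.bcBondConfig ω) (startCorner hE) t : ℝ) * I) =
      d * (starRingEnd ℂ) (I ^ (j : ℕ) * Complex.exp (-(Real.pi / 6 : ℝ) * I)) := by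
  obtain ⟨-, hxB, hb1, hb2, hf0, -, -⟩ := touchRow_of_chart he hδ hα hΩ hEδ hgood hX hY hn hn' hYl hYr hArc hA h1 h2
  have key := hPh x hA (by linarith [hδ]) (by linarith [hδ]) hf0 hxB hb1 hb2 ω t ht horb
  simp only [Complex.ofReal_neg] at key
  rw [mul_assoc] at key
  exact eq_mul_conj_of_mul_eq (norm_I_pow_mul_exp_neg j) key

include he hδ hα hΩ hEδ hgood hX hY hn hn' hYl hYr hArc hPh in
/-- **The chain sum of a free side, in the direction `d`.** For an exact pair of `E` at its mesh, (H1)/(H2), and a chain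
`x_i = x − i(u_j + u_{j+1})` of the window (`A x = n − 2`, `Yl + δ ≤ Y(δx)`, `Y(δ x_N) ≤ Yr − δ`):
`Ψ (faceAt x_N j) − Ψ (faceAt x j) = √3 · d · Σ_{i<N} touchProb E x_i`. -/
theorem free_chainSum_of_chart (hA1 : ((discreteDomainGraph E.Ω E.δ).induce E.zdArcA).Preconnected)
    (hB1 : ((zdGraph 2).induce E.zdArcB).Preconnected) {Φ Ψ : Site 2 → ℂ} (hP : IsExactPair E E.δ Φ Ψ) {x : Site 2}
    (hA : layerFn j x = n - 2) (h1 : Yl + δ ≤ ((meshPoint δ x - c) * e).im) (N : ℕ)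
    (h2 : ((meshPoint δ (x - (N : ℤ) • (cornerUnit j + cornerUnit (j + 1))) - c) * e).im ≤ Yr - δ) :
    Ψ (faceAt (x - (N : ℤ) • (cornerUnit j + cornerUnit (j + 1))) j) - Ψ (faceAt x j) =
      (Real.sqrt 3 : ℂ) * d * ∑ i ∈ Finset.range N, (touchProb E (x - (i : ℤ) • (cornerUnit j + cornerUnit (j + 1))) : ℂ) := by
  rcases N with _ | M
  · simp
  · set ζ : ℂ := d * (starRingEnd ℂ) (I ^ (j : ℕ) * Complex.exp (-(Real.pi / 6 : ℝ) * I)) with hζ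
    -- every chain site up to `M + 1` is in the window
    have hwin : ∀ i ≤ M + 1, Yl + δ ≤ ((meshPoint δ (x - (i : ℤ) • (cornerUnit j + cornerUnit (j + 1))) - c) * e).im ∧
        ((meshPoint δ (x - (i : ℤ) • (cornerUnit j + cornerUnit (j + 1))) - c) * e).im ≤ Yr - δ := by
      intro i hi
      rw [im_tilt_chainSite hY] at h2 ⊢
      have hi' : (i : ℝ) ≤ (M + 1 : ℕ) := by exact_mod_cast hi
      have hs : 0 ≤ Real.sqrt 2 * δ := by positivity
      constructor
      · nlinarith [hs, (Nat.cast_nonneg i : (0 : ℝ) ≤ i)]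
      · nlinarith
    have key := exactPair_chainSum_touchProb E hE hA1 hB1 Φ Ψ hP j ζ
      (fun i => x - (i : ℤ) • (cornerUnit j + cornerUnit (j + 1))) M (fun i _ => chainSite_succ j x i)
      (fun i hi => touchRow_of_chart he hδ hα hΩ hEδ hgood hX hY hn hn' hYl hYr hArc
        (by rw [layerFn_chainSite, hA]) (hwin i (Nat.le_succ_of_le hi)).1 (hwin i (Nat.le_succ_of_le hi)).2)
      (fun i hi ω t ht horb => phase_of_chart he hδ hα hΩ hEδ hE hgood hX hY hn hn' hYl hYr hArc hPh
        (by rw [layerFn_chainSite, hA]) (hwin i (Nat.le_succ_of_le hi)).1 (hwin i (Nat.le_succ_of_le hi)).2 ω t ht horb)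
    simp only [Nat.cast_zero, zero_smul, sub_zero] at key
    have hface : faceAt (x - ((M : ℕ) : ℤ) • (cornerUnit j + cornerUnit (j + 1))) (j + 2) =
        faceAt (x - ((M + 1 : ℕ) : ℤ) • (cornerUnit j + cornerUnit (j + 1))) j := by
      rw [chainSite_succ, faceAt_sub_units]
    rw [hface] at key
    rw [key]
    have hprod : I ^ (j : ℕ) * Complex.exp (-(Real.pi / 6 : ℝ) * I) * ζ = d := by
      rw [hζ]; exact mul_mul_conj_of_norm_one (norm_I_pow_mul_exp_neg j) d
    rw [hprod]

/-! ## Touch sites of the window: layers `n − 2` and `n − 3` -/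

include he hδ hα hΩ hEδ hE hgood hX hY hn hn' hYl hYr in
/-- **Touch sites of the window lie on the layers `n − 2` and `n − 3`.** -/
theorem layer_of_touchSite {y : Site 2} (hy : y ∈ touchSites E) (hA : n - 4 ≤ layerFn j y)
    (h1 : Yl + 2 * δ ≤ ((meshPoint δ y - c) * e).im) (h2 : ((meshPoint δ y - c) * e).im ≤ Yr - 2 * δ) :
    layerFn j y = n - 2 ∨ layerFn j y = n - 3 := by
  obtain ⟨hyA, hyB, F, hF, hyF, u, huF, huB⟩ := hy
  have hh : Real.sqrt 2 / 2 * δ ≤ δ := sqrt_two_half_mul_le hδ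
  -- `y` is in the carrier, off the boundary: layer `≤ n − 2`
  have hyin : meshPoint δ y ∈ E.Ω := by have := corner_mem_of_isInnerFace hF hyF; rwa [hEδ] at this
  obtain ⟨bY, bX⟩ := bulk_of_chart hδ hα hX hn' hYl hYr (x := y) (by omega) (by linarith) (by linarith)
  have hyn : layerFn j y ≤ n := (mem_carrier_iff_layerFn_le_self he hδ hΩ hX hn hn' bY bX).1 hyin
  have hyb : y ∉ E.zdBoundary := fun hb => (hE.zdBoundary_subset hb).elim hyA hyB
  have hup : layerFn j y ≤ n - 2 := by
    have := mem_zdBoundary_iff_layerFn' he hδ hΩ hEδ hgood hX hn hn' bY bX hyin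
    by_contra hlt
    exact hyb (this.2 (by omega))
  -- the `B`-corner `u` of `F`: a boundary site within chart distance `2` of `y`, so layer `≥ n − 1`
  have hcu := chart_of_isCorner j huF
  have hcy := chart_of_isCorner j hyF
  have hA3 := abs_sub_le (layerFn j u) (layerFn j F + layerTop j - 1) (layerFn j y)
  have hB3 := abs_sub_le (layerFn (j + 1) u) (layerFn (j + 1) F + layerTop (j + 1) - 1) (layerFn (j + 1) y)
  rw [abs_sub_comm (layerFn j F + layerTop j - 1)] at hA3
  rw [abs_sub_comm (layerFn (j + 1) F + layerTop (j + 1) - 1)] at hB3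
  have hAu : |layerFn j u - layerFn j y| ≤ 2 := by
    linarith [abs_nonneg (layerFn (j + 1) u - (layerFn (j + 1) F + layerTop (j + 1) - 1)),
      abs_nonneg (layerFn (j + 1) y - (layerFn (j + 1) F + layerTop (j + 1) - 1))]
  have hBu : |layerFn (j + 1) u - layerFn (j + 1) y| ≤ 2 := by
    linarith [abs_nonneg (layerFn j u - (layerFn j F + layerTop j - 1)), abs_nonneg (layerFn j y - (layerFn j F + layerTop j - 1))]
  have hYu : |((meshPoint δ u - c) * e).im - ((meshPoint δ y - c) * e).im| ≤ 2 * δ := by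
    rw [hY, hY, abs_le]
    have hBu' := abs_le.1 hBu
    have h1' : ((layerFn (j + 1) u : ℤ) : ℝ) - layerFn (j + 1) y ≤ 2 := by exact_mod_cast hBu'.2
    have h2' : (-2 : ℝ) ≤ ((layerFn (j + 1) u : ℤ) : ℝ) - layerFn (j + 1) y := by exact_mod_cast hBu'.1
    have hpos : 0 ≤ Real.sqrt 2 / 2 * δ := by positivity
    constructor <;> nlinarith
  have hYu' := abs_le.1 hYu
  have huin : meshPoint δ u ∈ E.Ω := by have := corner_mem_of_isInnerFace hF huF; rwa [hEδ] at this
  obtain ⟨buY, buX⟩ := bulk_of_chart hδ hα hX hn' hYl hYr (x := u) (by have := abs_le.1 hAu; omega) (by linarith)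
    (by linarith)
  have hub : n - 1 ≤ layerFn j u :=
    (mem_zdBoundary_iff_layerFn' he hδ hΩ hEδ hgood hX hn hn' buY buX huin).1 (E.zdArcB_subset_zdBoundary huB)
  have := abs_le.1 hAu
  omega

include he hδ hα hΩ hEδ hgood hX hY hn hn' hYl hYr in
/-- **FKG on the second touch layer**: a site of layer `n − 3` of the window has touch probability at most twice that
of its chain neighbour `y + u_{j+1}`. -/
theorem touchProb_le_two_mul_shift {y : Site 2} (hA : layerFn j y = n - 3) (h1 : Yl + δ ≤ ((meshPoint δ y - c) * e).im)
    (h2 : ((meshPoint δ y - c) * e).im ≤ Yr - δ) : touchProb E y ≤ 2 * touchProb E (y + cornerUnit (j + 1)) := by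
  have hh : Real.sqrt 2 / 2 * δ ≤ δ := sqrt_two_half_mul_le hδ
  obtain ⟨hY1, -, -, -⟩ := im_tilt_neighbours hY y
  have hA1 : layerFn j (y + cornerUnit (j + 1)) = n - 2 := by
    rw [layerFn_add_cornerUnit]; simp only [Matrix.cons_val_one, Matrix.cons_val_zero]; omega
  obtain ⟨-, -, hyB⟩ := not_mem_arcs_of_chart he hδ hα hΩ hEδ hgood hX hn hn' hYl hYr (x := y) (by omega) (by omega)
    (by linarith) (by linarith)
  obtain ⟨-, -, hy'B⟩ := not_mem_arcs_of_chart he hδ hα hΩ hEδ hgood hX hn hn' hYl hYr (x := y + cornerUnit (j + 1))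
    (by omega) (by omega) (by rw [hY1]; linarith) (by rw [hY1]; linarith)
  have hinner : E.IsInnerFace (faceAt y (j + 1)) :=
    isInnerFace_of_chart he hδ hα hΩ hEδ hgood hX hn hn' hYl hYr (by omega) (by linarith) (by linarith) 1
      (by simp [faceRise]; omega)
  have hadj : (discreteDomainGraph E.Ω E.δ).Adj y (y + cornerUnit (j + 1)) :=
    adj_of_isInnerFace_faceAt hinner (Or.inl rfl)
  exact touchProb_le_two_mul_of_adj E y _ hadj hyB hy'B

include he hδ hα hΩ hEδ hE hgood hX hY hn hn' hYl hYr in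
/-- **The touch mass of a window strictly between two chain sites is at most three times the chain sum between
them.** For a chain `x_i = x − i(u_j + u_{j+1})` of the window and a finite set `T` of touch sites of layer `≥ n − 4`
whose ordinates lie in `[Y(δx) + 2δ, Y(δ x_N) − 2δ]`: `Σ_{y ∈ T} touchProb E y ≤ 3 · Σ_{i<N} touchProb E x_i`. -/
theorem sum_touchProb_window_le' {x : Site 2} (hA : layerFn j x = n - 2) (h1 : Yl + δ ≤ ((meshPoint δ x - c) * e).im)
    (N : ℕ) (h2 : ((meshPoint δ (x - (N : ℤ) • (cornerUnit j + cornerUnit (j + 1))) - c) * e).im ≤ Yr - δ)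
    (T : Finset (Site 2)) (hT : ∀ y ∈ T, y ∈ touchSites E ∧ n - 4 ≤ layerFn j y ∧
      ((meshPoint δ x - c) * e).im + 2 * δ ≤ ((meshPoint δ y - c) * e).im ∧
      ((meshPoint δ y - c) * e).im + 2 * δ ≤ ((meshPoint δ (x - (N : ℤ) • (cornerUnit j + cornerUnit (j + 1))) - c) * e).im) :
    ∑ y ∈ T, touchProb E y ≤
      3 * ∑ i ∈ Finset.range N, touchProb E (x - (i : ℤ) • (cornerUnit j + cornerUnit (j + 1))) := by
  classical
  set F : ℕ → Site 2 := fun i => x - (i : ℤ) • (cornerUnit j + cornerUnit (j + 1)) with hF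
  have hh : Real.sqrt 2 / 2 * δ ≤ δ := sqrt_two_half_mul_le hδ
  have hNY := im_tilt_chainSite hY x N
  -- a chain-layer site strictly between `x` and `x_N` (in ordinate) is some `x_i`, `i < N`
  have mem_image : ∀ z : Site 2, layerFn j z = n - 2 → ((meshPoint δ x - c) * e).im < ((meshPoint δ z - c) * e).im →
      ((meshPoint δ z - c) * e).im < ((meshPoint δ (F N) - c) * e).im → z ∈ (Finset.range N).image F := by
    intro z hz hlo hhi
    obtain ⟨m, hm⟩ := layerFn_add_layerFn_succ_even j x
    obtain ⟨m', hm'⟩ := layerFn_add_layerFn_succ_even j z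
    have hlo' := (layerFn_succ_lt_iff hδ hY x z).1 hlo
    have hhi' := (layerFn_succ_lt_iff hδ hY z (F N)).1 hhi
    rw [hF] at hhi'
    simp only at hhi'
    rw [layerFn_succ_chainSite] at hhi'
    refine Finset.mem_image.2 ⟨(m' - m).toNat, Finset.mem_range.2 (by omega), ?_⟩
    rw [hF]
    exact (eq_chainSite_of_layerFn j (by rw [hz, hA]) (by omega)).symm
  have hinj : Set.InjOn F ↑(Finset.range N) := fun a _ b _ h => chainSite_injective j x h
  have hsumF : ∑ z ∈ (Finset.range N).image F, touchProb E z = ∑ i ∈ Finset.range N, touchProb E (F i) :=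
    Finset.sum_image hinj
  -- split `T` by layer
  rw [← Finset.sum_filter_add_sum_filter_not T (fun y => layerFn j y = n - 2)]
  have hwin : ∀ y ∈ T, Yl + 2 * δ ≤ ((meshPoint δ y - c) * e).im ∧ ((meshPoint δ y - c) * e).im ≤ Yr - 2 * δ := by
    intro y hy
    obtain ⟨-, -, hy1, hy2⟩ := hT y hy
    constructor <;> linarith
  -- the chain layer
  have h1st : ∑ y ∈ T.filter (fun y => layerFn j y = n - 2), touchProb E y ≤ ∑ i ∈ Finset.range N, touchProb E (F i) := by
    rw [← hsumF]
    refine Finset.sum_le_sum_of_subset_of_nonneg (fun y hy => ?_) fun _ _ _ => touchProb_nonneg E _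
    rw [Finset.mem_filter] at hy
    obtain ⟨-, -, hy1, hy2⟩ := hT y hy.1
    exact mem_image y hy.2 (by linarith) (by linarith)
  -- the second layer, shifted onto the chain layer
  have h2nd : ∑ y ∈ T.filter (fun y => ¬ layerFn j y = n - 2), touchProb E y ≤
      2 * ∑ i ∈ Finset.range N, touchProb E (F i) := by
    set T₂ := T.filter (fun y => ¬ layerFn j y = n - 2) with hT₂
    have hlayer : ∀ y ∈ T₂, layerFn j y = n - 3 := by
      intro y hy
      rw [hT₂, Finset.mem_filter] at hy
      obtain ⟨hyt, hyA, -, -⟩ := hT y hy.1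
      exact (layer_of_touchSite he hδ hα hΩ hEδ hE hgood hX hY hn hn' hYl hYr hyt hyA (hwin y hy.1).1 (hwin y hy.1).2).resolve_left hy.2
    have hstep : ∑ y ∈ T₂, touchProb E y ≤ ∑ y ∈ T₂, 2 * touchProb E (y + cornerUnit (j + 1)) := by
      refine Finset.sum_le_sum fun y hy => ?_
      have hyT : y ∈ T := (Finset.mem_filter.1 (hT₂ ▸ hy)).1
      exact touchProb_le_two_mul_shift he hδ hα hΩ hEδ hgood hX hY hn hn' hYl hYr (hlayer y hy)
        (by linarith [(hwin y hyT).1]) (by linarith [(hwin y hyT).2])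
    have hinj' : Set.InjOn (fun y : Site 2 => y + cornerUnit (j + 1)) ↑T₂ := fun a _ b _ h => add_right_cancel h
    have himage : T₂.image (fun y => y + cornerUnit (j + 1)) ⊆ (Finset.range N).image F := by
      intro z hz
      obtain ⟨y, hy, rfl⟩ := Finset.mem_image.1 hz
      have hyT : y ∈ T := (Finset.mem_filter.1 (hT₂ ▸ hy)).1
      obtain ⟨-, -, hy1, hy2⟩ := hT y hyT
      obtain ⟨hY1, -, -, -⟩ := im_tilt_neighbours hY y
      refine mem_image _ ?_ (by rw [hY1]; linarith) (by rw [hY1]; linarith)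
      rw [layerFn_add_cornerUnit]; simp only [Matrix.cons_val_one, Matrix.cons_val_zero]; linarith [hlayer y hy]
    calc ∑ y ∈ T₂, touchProb E y ≤ ∑ y ∈ T₂, 2 * touchProb E (y + cornerUnit (j + 1)) := hstep
      _ = 2 * ∑ z ∈ T₂.image (fun y => y + cornerUnit (j + 1)), touchProb E z := by
          rw [Finset.mul_sum, Finset.sum_image hinj']
      _ ≤ 2 * ∑ z ∈ (Finset.range N).image F, touchProb E z :=
          mul_le_mul_of_nonneg_left (Finset.sum_le_sum_of_subset_of_nonneg himage fun _ _ _ => touchProb_nonneg E _)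
            (by norm_num)
      _ = 2 * ∑ i ∈ Finset.range N, touchProb E (F i) := by rw [hsumF]
  linarith

end Core

/-- **The touch mass of a window is dominated by the chain sum** (registered helper of `stub_exactPotentialTracePh3`,
frame form). For admissible data `E` on the open tilted rectangle of a side frame read at its mesh `δ` (`4δ ≤ α`), every
lattice point of the rectangle in `Ω_δ`, chart `(δ/√2)·layerFn j + X₀` across / `(δ/√2)·layerFn (j+1) + Y₀` along, last
inside layer `n`, and a window of ordinates `[Yl, Yr]` with `−β + 3δ < Yl`, `Yr + 3δ < β`: for a chain `x_i = x − i(u_j +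
u_{j+1})`, `layerFn j x = n − 2`, `Yl + δ ≤ Y(δx)`, `Y(δ x_N) ≤ Yr − δ`, and a finite set `T` of touch sites of layer
`≥ n − 4` with ordinates in `[Y(δx) + 2δ, Y(δ x_N) − 2δ]`: `Σ_{y ∈ T} touchProb E y ≤ 3 · Σ_{i<N} touchProb E x_i`. -/
theorem sum_touchProb_window_le : ∀ (c e : ℂ), ‖e‖ = 1 → ∀ (α β δ : ℝ), 0 < δ → 4 * δ ≤ α → ∀ (E : DiscreteDobrushin), E.Ω = {z : ℂ | |((z - c) * e).re| < α ∧ |((z - c) * e).im| < β} → E.δ = δ → E.IsZdAdmissible → (∀ x : Site 2, meshPoint δ x ∈ E.Ω → x ∈ meshDomain E.Ω δ) → ∀ (j : Fin 4) (X₀ Y₀ : ℝ), (∀ x : Site 2, ((meshPoint δ x - c) * e).re = Real.sqrt 2 / 2 * δ * layerFn j x + X₀) → (∀ x : Site 2, ((meshPoint δ x - c) * e).im = Real.sqrt 2 / 2 * δ * layerFn (j + 1) x + Y₀) → ∀ (n : ℤ), Real.sqrt 2 / 2 * δ * n + X₀ < α → α ≤ Real.sqrt 2 / 2 * δ * (n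 + 1) + X₀ → ∀ (Yl Yr : ℝ), -β + 3 * δ < Yl → Yr + 3 * δ < β → ∀ (x : Site 2), layerFn j x = n - 2 → Yl + δ ≤ ((meshPoint δ x - c) * e).im → ∀ (N : ℕ), ((meshPoint δ (x - (N : ℤ) • (cornerUnit j + cornerUnit (j + 1))) - c) * e).im ≤ Yr - δ → ∀ (T : Finset (Site 2)), (∀ y ∈ T, y ∈ touchSites E ∧ n - 4 ≤ layerFn j y ∧ ((meshPoint δ x - c) * e).im + 2 * δ ≤ ((meshPoint δ y - c) * e).im ∧ ((meshPoint δ y - c) * e).im + 2 * δ ≤ ((meshPoint δ (x - (N : ℤ) • (cornerUnit j + cornerUnit (j + 1))) - c) * e).im) → ∑ y ∈ T, touchProb E y ≤ 3 * ∑ i ∈ Finset.range N, touchProb E (x - (i : ℤ) • (cornerUnit j + cornerUnit (j + 1))) := by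
  intro c e he α β δ hδ hα E hΩ hEδ hE hgood j X₀ Y₀ hX hY n hn hn' Yl Yr hYl hYr x hA h1 N h2 T hT
  exact sum_touchProb_window_le' he hδ hα hΩ hEδ hE hgood hX hY hn hn' hYl hYr hA h1 N h2 T hT

end Summit.CriticalPhenomena.CardyFormulaZ2.Cruxes.ParafermionToSLESixFamilies.PotentialDarbouxPicardDiamond

end
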